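/-
Origin: expansion seat `planner-pub-hodgecm-landherr-g2-0`, handover 2026-08-18T03:40:09Z (`HOME/pub-hodgecm-landherr-g2/EndState.lean`, md5 0010df87, 48 lines);
landed by the gen-5 packager in gate run 19 as `HodgeCM/Assembly/CorCMEndState.lean` (import ^import LandherrG2\.SeesawConstruction\b→import HodgeCM.Proofs.SeesawConstruction ×1).
-/
/-
Copyright: pub-hodgecm formalisation cell (harness21, 2026). New file (not vendored).
Origin: HOME/pub-hodgecm-landherr-g2/EndState.lean — session planner-pub-hodgecm-landherr-g2-0 (unit
pub-hodgecm-landherr-g2, gen 2).  OPTIONAL convenience file (the packager's "NET STATE one-liner", run-17 Log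
03:29:00Z, with `HasseMinkowskiQuinary` and `LevelDirected` gone).  Intended final place:
`HodgeCM/Assembly/CorCMEndState.lean`; `import LandherrG2.SeesawConstruction` → `HodgeCM.Proofs.SeesawConstruction`.
-/
import Summits.HodgeConjecture.HodgeCM.Proofs.SeesawConstruction_2
import Summits.HodgeConjecture.HodgeCM.Proofs.PohlmannSpan
import Summits.HodgeConjecture.HodgeCM.StubTree.Qw8FaceBridge

set_option autoImplicit false

/-!
# The composite end state of the cell's headline, as ONE theorem

`COR_CM (M) (hR) (hP) (hQ)` (`HodgeCM.Assembly.CorCM`) with every in-package discharge plugged in: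
`hR := ThetaModel.realisationExistsFace_of'' M A hHR` (`HodgeCM.Proofs.SeesawConstruction` — no `Lemma33bLandherr`, no
`HasseMinkowskiQuinary`, no `LevelDirected`), `hP := Universe.pohlmannSpan_holds M h29 h30` (`HodgeCM.Proofs.PohlmannSpan`,
run 17), `hQ := Universe.qw8Sufficiency_of_modelAxioms M hE hD hMi` (`HodgeCM.StubTree.Qw8FaceBridge`, run 16).  So

  `HC_CM ⇐ ModelAxioms ∧ Fact_weightSpan (M29) ∧ Fact_weightHodge (M30) ∧ Qw8ExtProd ∧ Qw8DualPushPull ∧ Qw8Milne ∧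
           ThetaModel.Inputs T ∧ Fact_hodgeRiemann20`

and `PerL ⇐ ModelAxioms ∧ ThetaModel.Inputs T ∧ Fact_hodgeRiemann20` (`Assembly.perL_theta''`).  Nothing new is proved
here; the file only composes landed theorems so that the audited list can carry the end state under one name.
-/

noncomputable section

namespace HodgeCM
namespace Assembly

variable (U : Universe)

/-- **COR-CM, end state of the cell** (every in-package discharge plugged in; remaining hypotheses = the 28 model
facts `M`, the two weight facts M29/M30, the three [QW8]-side inputs, the ten theta-model inputs `T.Inputs`
(2 PRINT, 2 DESIGN, 6 PerL OPEN INPUTS) and Hodge–Riemann for `(2,0)`-forms). -/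
theorem COR_CM_endState (M : U.ModelAxioms) (h29 : U.Fact_weightSpan) (h30 : U.Fact_weightHodge)
    (hE : U.Qw8ExtProd) (hD : U.Qw8DualPushPull) (hMi : U.Qw8Milne)
    (T : U.ThetaModel) (A : T.Inputs) (hHR : U.Fact_hodgeRiemann20) : U.HC_CM :=
  COR_CM_theta'' U M T A hHR (Universe.pohlmannSpan_holds M h29 h30)
    (Universe.qw8Sufficiency_of_modelAxioms M hE hD hMi)

end Assembly
end HodgeCM

end
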